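import Literature.Probability.LatticeModels.DartFlux
import Literature.Probability.LatticeModels.HoleFreePotential
import Literature.Probability.LatticeModels.ObservableAprioriBound
import HarnessLib

/-!
# The discrete primitive `H = Im ∫ F²` of the FK-Ising observable on a hole-free discrete domain

Topic `Literature/Probability/LatticeModels`; an instalment of the discharge programme for
crit-ising.S18 (`Sweep1Proofs.lean`: Smirnov's Theorem 2.2), nodes 2–4 of the DAG recorded there,
assembling `DartFlux.lean` (Lemmas 3.6/4.5/4.11 per edge), `HoleFreePotential.lean` (the discrete
Poincaré lemma) and `ObservableAprioriBound.lean` (Lemma 4.8). Everything here is proved.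

* `isCornerClosedOn_dartFlux` (**Lemma 3.6, closedness everywhere**): for admissible data with
  connected wired arc (H1), Smirnov's flux form `q ↦ |F(q)|² = dartFlux E hE q` is closed around
  every edge of `Ω_δ` both of whose faces are inner — free edges by Lemma 4.5
  (`dartFlux_closed_free`), `A`–`A` edges (always open) and edges touching `B` (always closed) by
  the forced-transition relations of Lemma 4.11.
* `IsFKPrimitive E hE Hw Hb`: `(Hw, Hb)` is a discrete primitive of the critical FK-Ising observable
  of `E` — `Hb f - Hw v = |F(v, f)|²` across every corner of every inner face (Lemma 3.6, eq. (3.3),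
  with the tree's colours: `Hw` on the sites of `ℤ²`, `Hb` on the faces, `H` increasing from a site
  to its faces). **`exists_isFKPrimitive`**: such a primitive exists as soon as the set of inner
  faces is hole-free (`HoleFree`, the combinatorial simple connectivity of `HoleFreePotential`).
* Boundary behaviour of any primitive (Lemmas 3.10, 4.11 in the tree's rendering):
  `IsFKPrimitive.hb_eq_hw_of_mem_zdArcB` (`H` does not jump between a site of the free arc `B` and
  its inner faces), `IsFKPrimitive.hw_eq_hw_of_arcA` (`Hw` takes equal values at the two ends of an
  `A`–`A` edge bordering an inner face), `IsFKPrimitive.jump_startCorner` (across the start edge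
  `e_a = {a, b''}`: `Hw b'' - Hw a = 1`).
* `dartFlux_le_passageProb_sq`, `dartFlux_le_of_infDist` (**Lemma 4.8 for the fluxes**): a dart is
  used at most once and only if the interface passes through its source edge, so
  `|F(q)|² ≤ P(cSrc q ∈ γ)² ≤ ρ_r(δ)²` for darts sourced `r`-away from one of the arcs.

What is *not* here: that the inner faces of the discretisations of a Jordan domain are hole-free
(plane topology of the domain), the connectivity of the arcs through inner faces (needed to make
the boundary values of `H` two global constants), and Lemma 3.8 near the arcs.

## References

* S. Smirnov, *Conformal invariance in random cluster models. I*, Ann. of Math. 172 (2010)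
  1435–1467: Lemma 3.6, Lemma 3.10, Lemma 4.8, Lemma 4.11 — bib key `Smirnov2010`.
-/

noncomputable section

open MeasureTheory Filter Topology
open scoped NNReal ENNReal

namespace Literature.Probability.LatticeModels

open Finset SimpleGraph

namespace DiscreteDobrushin

/-- The set of inner faces of discrete Dobrushin data (faces all of whose sides are edges of
`Ω_δ`), indexed by lower-left corners. [cite: Smirnov2001, §2] -/
def innerFaces (E : DiscreteDobrushin) : Set (Site 2) := {f | E.IsInnerFace f}

/-- Membership in `innerFaces`. [cite: Smirnov2001, §2] -/
@[simp] theorem mem_innerFaces_iff (E : DiscreteDobrushin) (f : Site 2) : f ∈ E.innerFaces ↔ E.IsInnerFace f := Iff.rfl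

/-- For bounded data with positive mesh there are finitely many inner faces. [cite: CDHKSCRAS2014, §1] -/
theorem innerFaces_finite (E : DiscreteDobrushin) (hΩ : Bornology.IsBounded E.Ω) (hδ : 0 < E.δ) : E.innerFaces.Finite :=
  finite_hasAllSides hΩ hδ

end DiscreteDobrushin

variable {E : DiscreteDobrushin}

/-! ### Lemma 3.6: the flux form is closed on the inner faces -/

/-- A side of an inner face, written `cSrc (u, k)` with the face `faceAt u k` or `faceAt u (k + 3)`,
is an edge of `Ω_δ`. [cite: Smirnov2001, §2] -/
theorem cSrc_mem_edgeSet_of_isInnerFace {u : Site 2} {k : Fin 4}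
    (h : E.IsInnerFace (faceAt u k) ∨ E.IsInnerFace (faceAt u (k + 3))) :
    cSrc (u, k) ∈ (discreteDomainGraph E.Ω E.δ).edgeSet := by
  rcases h with h | h
  · exact DiscreteDobrushin.adj_of_isInnerFace_faceAt h (Or.inl rfl)
  · exact DiscreteDobrushin.adj_of_isInnerFace_faceAt h (Or.inr rfl)

/-- **Smirnov's Lemma 3.6 for the FK observable: the flux form is closed.** For admissible data
with connected wired arc (H1), the dart fluxes `|F(q)|²` are closed around every edge both of
whose faces are inner: going around such an edge through its four squares the signed increments of
`H` cancel. Free edges: Lemma 4.5 and Pythagoras (`dartFlux_closed_free`); `A`–`A` edges (open in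
every completed configuration) and edges with an endpoint on `B` (closed in every completed
configuration): the passages through a dart and its forced successor correspond, with equal fluxes
(`dartFlux_follow_eq`, `dartFlux_cross_eq`). [cite: Smirnov2010, Lemma 3.6 with Lemmas 4.5 and 4.11] -/
theorem isCornerClosedOn_dartFlux [Fintype (meshDomain E.Ω E.δ)] (hE : E.IsZdAdmissible)
    (hA : ((discreteDomainGraph E.Ω E.δ).induce E.zdArcA).Preconnected) :
    IsCornerClosedOn (dartFlux E hE) E.innerFaces := by
  intro u k h₁ h₂
  rw [DiscreteDobrushin.mem_innerFaces_iff] at h₁ h₂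
  -- the four darts at the edge `z = {u, u + e_k}` and their faces
  have e31 : k + 3 + 1 = k := by omega
  have e32 : k + 3 + 2 = k + 1 := by omega
  have e33 : k + 3 + 3 = k + 2 := by omega
  have e11 : k + 1 + 1 = k + 2 := by omega
  have e13 : k + 1 + 3 = k := by omega
  have hz : cSrc (u, k) ∈ (discreteDomainGraph E.Ω E.δ).edgeSet := cSrc_mem_edgeSet_of_isInnerFace (Or.inl h₁)
  have htgt₁ : cTgt (u, k + 3) = cSrc (u, k) := cTgt_add_three u k
  have htgt₂ : cTgt (u + cornerUnit k, k + 1) = cSrc (u, k) := cTgt_add_cornerUnit_succ u k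
  have hf₁ : E.IsInnerFace (cFace (u, k + 3)) := h₂
  have hf₂ : E.IsInnerFace (cFace (u + cornerUnit k, k + 1)) := by
    change E.IsInnerFace (faceAt (u + cornerUnit k) (k + 1)); rw [faceAt_add_unit_succ]; exact h₁
  unfold IsCornerClosedAt
  by_cases hB : ∃ x ∈ cSrc (u, k), x ∈ E.zdArcB
  · -- an edge touching `B`: closed in every completed configuration
    obtain ⟨x, hx, hxB⟩ := hB
    have hclosed : ∀ ω : Percolation.BondConfig (Site 2), cSrc (u, k) ∉ E.bcBondConfig ω :=
      forall_not_mem_bcBondConfig_of_arcB hE hx hxB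
    have c₁ := dartFlux_cross_eq hE (q := (u, k + 3)) hf₁ (by simp only [e31]; exact h₁) (by rw [htgt₁]; exact hclosed)
    have c₂ := dartFlux_cross_eq hE (q := (u + cornerUnit k, k + 1)) hf₂
      (by simp only [e11]; rw [faceAt_add_unit_add_two]; exact h₂) (by rw [htgt₂]; exact hclosed)
    simp only [e31, e11] at c₁ c₂
    linarith
  · push Not at hB
    by_cases hAA : u ∈ E.zdArcA ∧ u + cornerUnit k ∈ E.zdArcA
    · -- an `A`–`A` edge: open in every completed configuration
      have hopen : ∀ ω : Percolation.BondConfig (Site 2), cSrc (u, k) ∈ E.bcBondConfig ω :=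
        forall_mem_bcBondConfig_of_arcA hz (fun x hx => by
          rcases Sym2.mem_iff.1 hx with rfl | rfl
          · exact hAA.1
          · exact hAA.2)
      have c₁ := dartFlux_follow_eq hE (q := (u, k + 3)) hf₁ (by rw [htgt₁]; exact hopen)
      have c₂ := dartFlux_follow_eq hE (q := (u + cornerUnit k, k + 1)) hf₂ (by rw [htgt₂]; exact hopen)
      simp only [e31, e33, e11, e13] at c₁ c₂
      rw [cornerUnit_add_two, ← sub_eq_add_neg, add_sub_cancel_right] at c₂
      linarith
    · -- a free edge: Lemma 4.5
      have hfree := dartFlux_closed_free hE hA (p := (u, k + 3)) (by rw [htgt₁]; exact hz)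
        (by rw [htgt₁]; exact hB) (by simp only [e31]; exact hAA) hf₁
        (by change E.IsInnerFace (cFace (u + cornerUnit (k + 3 + 1), k + 3 + 2)); rw [e31, e32]; exact hf₂)
      change dartFlux E hE (u, k + 3) + dartFlux E hE (u + cornerUnit (k + 3 + 1), k + 3 + 2) =
        dartFlux E hE (u, k + 3 + 1) + dartFlux E hE (u + cornerUnit (k + 3 + 1), k + 3 + 3) at hfree
      simp only [e31, e32, e33] at hfree
      linarith

/-! ### The primitive -/

/-- **`(Hw, Hb)` is a discrete primitive `H = Im ∫ F²` of the critical FK-Ising observable** of the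
admissible data `E`: `Hw` on the sites of `ℤ²`, `Hb` on the faces (lower-left corners), and across
every corner `q = (v, k)` of every inner face, `Hb (cFace q) - Hw v = |F(q)|² = dartFlux E hE q`
(Smirnov 2010, Lemma 3.6, eq. (3.3): "`H(B) - H(W) = |F(e)|²`"; tree colours: sites = Smirnov's
white squares, faces = black squares, cf. Remark 3.9). [cite: Smirnov2010, Lemma 3.6 eq. (3.3)] -/
def IsFKPrimitive (E : DiscreteDobrushin) [Fintype (meshDomain E.Ω E.δ)] (hE : E.IsZdAdmissible)
    (Hw Hb : Site 2 → ℝ) : Prop :=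
  ∀ q : Site 2 × Fin 4, E.IsInnerFace (cFace q) → Hb (cFace q) - Hw q.1 = dartFlux E hE q

/-- **Existence of the discrete primitive on hole-free domains** (Smirnov 2010, Lemma 3.6: "up to a
constant there is a unique function `H`", for simply connected lattice domains). For admissible
data with connected wired arc whose set of inner faces is hole-free, the critical FK-Ising
observable has a discrete primitive. [cite: Smirnov2010, Lemma 3.6] -/
theorem exists_isFKPrimitive [Fintype (meshDomain E.Ω E.δ)] (hE : E.IsZdAdmissible)
    (hA : ((discreteDomainGraph E.Ω E.δ).induce E.zdArcA).Preconnected) (hHF : HoleFree E.innerFaces) :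
    ∃ Hw Hb : Site 2 → ℝ, IsFKPrimitive E hE Hw Hb := by
  have hfin := E.innerFaces_finite hE.isBounded hE.delta_pos
  have hcoe : (↑hfin.toFinset : Set (Site 2)) = E.innerFaces := Set.Finite.coe_toFinset hfin
  obtain ⟨Hw, Hb, h⟩ := exists_potential_of_holeFree (dartFlux E hE) hfin.toFinset (by rw [hcoe]; exact hHF)
    (by rw [hcoe]; exact isCornerClosedOn_dartFlux hE hA)
  refine ⟨Hw, Hb, fun q hq => h q ?_⟩
  rw [mem_faceSetCorners, hcoe]
  exact hq

namespace IsFKPrimitive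

variable [Fintype (meshDomain E.Ω E.δ)] {hE : E.IsZdAdmissible} {Hw Hb : Site 2 → ℝ}

/-- `H` increases from a site to its inner faces. [cite: Smirnov2010, Remark 3.9] -/
theorem hw_le_hb (h : IsFKPrimitive E hE Hw Hb) {v : Site 2} {k : Fin 4} (hf : E.IsInnerFace (faceAt v k)) :
    Hw v ≤ Hb (faceAt v k) := by
  have := h (v, k) hf
  have h0 := dartFlux_nonneg hE (v, k)
  simp only [cFace] at this
  linarith

/-- **No jump at the free arc** (Lemma 3.10/4.11 in the tree's rendering of the dual-wired arc): at
a site `b ∈ B`, `Hb f = Hw b` for every inner face `f` at `b`. [cite: Smirnov2010, Lemma 3.10 and Lemma 4.11] -/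
theorem hb_eq_hw_of_mem_zdArcB (h : IsFKPrimitive E hE Hw Hb) {b : Site 2} (hb : b ∈ E.zdArcB) {k : Fin 4}
    (hf : E.IsInnerFace (faceAt b k)) : Hb (faceAt b k) = Hw b := by
  have := h (b, k) hf
  rw [dartFlux_eq_zero_of_mem_zdArcB hE (q := (b, k)) hb] at this
  simp only [cFace] at this
  linarith

/-- **`Hw` is locally constant along the wired arc** (Lemma 3.10/4.11): at the two ends of an
`A`–`A` edge `{u, u + e_k}` of `Ω_δ` bordering an inner face (on either side), `Hw` takes the same
value — the two darts of that face at the edge carry equal fluxes because the edge is always open.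
[cite: Smirnov2010, Lemma 3.10 and Lemma 4.11] -/
theorem hw_eq_hw_of_arcA (h : IsFKPrimitive E hE Hw Hb) {u : Site 2} {k : Fin 4} (hu : u ∈ E.zdArcA)
    (hu' : u + cornerUnit k ∈ E.zdArcA) (hf : E.IsInnerFace (faceAt u k) ∨ E.IsInnerFace (faceAt u (k + 3))) :
    Hw u = Hw (u + cornerUnit k) := by
  have hz : cSrc (u, k) ∈ (discreteDomainGraph E.Ω E.δ).edgeSet := cSrc_mem_edgeSet_of_isInnerFace hf
  have hopen : ∀ ω : Percolation.BondConfig (Site 2), cSrc (u, k) ∈ E.bcBondConfig ω :=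
    forall_mem_bcBondConfig_of_arcA hz (fun x hx => by
      rcases Sym2.mem_iff.1 hx with rfl | rfl
      · exact hu
      · exact hu')
  rcases hf with hf | hf
  · -- the face `faceAt u k`: darts `(u + e_k, k + 1)` (arriving) and `(u, k)` (leaving)
    have e11 : k + 1 + 1 = k + 2 := by omega
    have e13 : k + 1 + 3 = k := by omega
    have hf₂ : E.IsInnerFace (cFace (u + cornerUnit k, k + 1)) := by
      change E.IsInnerFace (faceAt (u + cornerUnit k) (k + 1)); rw [faceAt_add_unit_succ]; exact hf
    have c := dartFlux_follow_eq hE (q := (u + cornerUnit k, k + 1)) hf₂ (by rw [cTgt_add_cornerUnit_succ]; exact hopen)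
    simp only [e11, e13] at c
    rw [cornerUnit_add_two, ← sub_eq_add_neg, add_sub_cancel_right] at c
    have p₁ := h (u, k) hf
    have p₂ := h (u + cornerUnit k, k + 1) hf₂
    simp only [cFace] at p₁ p₂
    rw [faceAt_add_unit_succ] at p₂
    linarith
  · -- the face `faceAt u (k + 3)`: darts `(u, k + 3)` (arriving) and `(u + e_k, k + 2)` (leaving)
    have e31 : k + 3 + 1 = k := by omega
    have e33 : k + 3 + 3 = k + 2 := by omega
    have hf₁ : E.IsInnerFace (cFace (u, k + 3)) := hf
    have c := dartFlux_follow_eq hE (q := (u, k + 3)) hf₁ (by rw [cTgt_add_three]; exact hopen)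
    simp only [e31, e33] at c
    have p₁ := h (u, k + 3) hf
    have p₂ := h (u + cornerUnit k, k + 2) (by
      change E.IsInnerFace (faceAt (u + cornerUnit k) (k + 2)); rw [faceAt_add_unit_add_two]; exact hf)
    simp only [cFace] at p₁ p₂
    rw [faceAt_add_unit_add_two] at p₂
    linarith

/-- **The jump across the start edge** `e_a = {a, b''}` (`a = c₀.1 ∈ A`, `b'' ∈ B`): the primitive
at the `B`-end exceeds the primitive at the `A`-end by exactly `1` — the tree's form of Smirnov's
boundary values "`H = 0` on `(ab)`, `H = 1` on `(ba)`" (Lemma 4.11), the unit jump sitting at the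
winding origin `e_a`. [cite: Smirnov2010, Lemma 4.11] -/
theorem jump_startCorner (h : IsFKPrimitive E hE Hw Hb) :
    Hw ((DiscreteDobrushin.startCorner hE).1 + cornerUnit (DiscreteDobrushin.startCorner hE).2) =
      Hw (DiscreteDobrushin.startCorner hE).1 + 1 := by
  set c₀ := DiscreteDobrushin.startCorner hE with hc₀def
  have hc₀ : E.IsStartCorner c₀ := DiscreteDobrushin.isStartCorner_startCorner hE
  have hf : E.IsInnerFace (cFace c₀) := hc₀.isOutEdge.1
  have p₁ := h c₀ hf
  rw [dartFlux_startCorner] at p₁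
  -- the `B`-end `b'' = c₀.1 + e_{c₀.2}` is a corner of the face of `c₀`
  have hf' : E.IsInnerFace (faceAt (c₀.1 + cornerUnit c₀.2) (c₀.2 + 1)) := by rw [faceAt_add_unit_succ]; exact hf
  have p₂ := h.hb_eq_hw_of_mem_zdArcB hc₀.mem_zdArcB hf'
  rw [faceAt_add_unit_succ] at p₂
  simp only [cFace] at p₁
  linarith

end IsFKPrimitive

/-! ### Lemma 4.8 for the fluxes -/

open scoped Classical in
/-- A dart is used at most once, and only when the interface passes through its source edge:
`‖F(q)‖ ≤ P(cSrc q ∈ γ)`. [cite: Smirnov2010, proof of Lemma 4.8] -/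
theorem norm_dartObs_le_passageProb [inst : Fintype (meshDomain E.Ω E.δ)] (hE : E.IsZdAdmissible)
    (q : Site 2 × Fin 4) :
    ‖dartObs E hE q‖ ≤ (fkDobrushinMeasure E).real {ω | cSrc q ∈ fkInterface E ω} := by
  have hinst : (meshDomain_finite hE.isBounded hE.delta_pos).fintype = inst := Subsingleton.elim _ _
  rw [fkDobrushinMeasure_of_pos E hE.isBounded hE.delta_pos, hinst,
    DiscreteDobrushin.fkInterfaceMeasure_real_apply E criticalFKIsingParam_mem_Icc two_pos]
  unfold dartObs
  refine (norm_sum_le _ _).trans (Finset.sum_le_sum fun ω _ => ?_)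
  have hc₀ : E.IsStartCorner (DiscreteDobrushin.startCorner hE) := DiscreteDobrushin.isStartCorner_startCorner hE
  set β := E.bcBondConfig (liftConfig E.Ω E.δ ω)
  set N := DiscreteDobrushin.exitTime hE (liftConfig E.Ω E.δ ω)
  have hw : 0 ≤ rcWeight E.interfaceGraph criticalFKIsingParam 2 (Subtype.val ⁻¹' E.zdArcA) ω /
      rcPartitionFunction E.interfaceGraph criticalFKIsingParam 2 (Subtype.val ⁻¹' E.zdArcA) :=
    div_nonneg (rcWeight_nonneg _ criticalFKIsingParam_mem_Icc zero_le_two _ ω)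
      (rcPartitionFunction_pos _ criticalFKIsingParam_mem_Icc two_pos _).le
  rw [norm_mul, Complex.norm_real, Real.norm_of_nonneg hw]
  refine mul_le_mul_of_nonneg_left ?_ hw
  -- the inner sum has at most one term, of norm one, and is empty unless `cSrc q ∈ γ`
  set S := (Finset.range N).filter (fun j => cornerOrbit β (DiscreteDobrushin.startCorner hE) j = q) with hS
  have hcard : S.card ≤ 1 := by
    rw [Finset.card_le_one]
    intro i hi j hj
    rw [hS, Finset.mem_filter, Finset.mem_range] at hi hj
    by_contra hne
    rcases Nat.lt_or_gt_of_ne hne with hlt | hlt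
    · exact cornerOrbit_ne hE hc₀ hlt (fun k hk => DiscreteDobrushin.isInnerFace_of_lt_exitTime hE _ (by omega))
        (hi.2.trans hj.2.symm)
    · exact cornerOrbit_ne hE hc₀ hlt (fun k hk => DiscreteDobrushin.isInnerFace_of_lt_exitTime hE _ (by omega))
        (hj.2.trans hi.2.symm)
  refine (norm_sum_le _ _).trans ?_
  simp only [norm_quarterPhase, Finset.sum_const, nsmul_eq_mul, mul_one]
  split_ifs with hmem
  · exact_mod_cast hcard
  · -- no passage: the filter is empty
    have : S = ∅ := by
      rw [Finset.eq_empty_iff_forall_notMem]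
      intro j hj
      rw [hS, Finset.mem_filter, Finset.mem_range] at hj
      apply hmem
      change cSrc q ∈ fkInterface E (liftConfig E.Ω E.δ ω)
      rw [fkInterface, DiscreteDobrushin.medialExploration_eq_explorationList hE, ← hj.2]
      exact List.mem_iff_getElem.2 ⟨j, by rw [length_explorationList']; omega, getElem_explorationList' _⟩
    rw [this]
    simp

/-- **`|F(q)|² ≤ P(cSrc q ∈ γ)²`.** [cite: Smirnov2010, proof of Lemma 4.8] -/
theorem dartFlux_le_passageProb_sq [Fintype (meshDomain E.Ω E.δ)] (hE : E.IsZdAdmissible) (q : Site 2 × Fin 4) :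
    dartFlux E hE q ≤ ((fkDobrushinMeasure E).real {ω | cSrc q ∈ fkInterface E ω}) ^ 2 := by
  unfold dartFlux
  have h0 : 0 ≤ ‖dartObs E hE q‖ := norm_nonneg _
  have := norm_dartObs_le_passageProb hE q
  nlinarith

/-- **Smirnov's Lemma 4.8 for the fluxes.** For every `r > 0` there is `ρ_r` with `ρ_r(δ) → 0`
(`δ → 0⁺`) such that, for all admissible discrete Dobrushin data `E` on `δℤ²` discretising a Jordan
domain and every dart `q` whose source edge is an edge of `Ω_δ` at distance `≥ r` from the discrete
arc `A` or from the discrete arc `B`, the increment of the discrete primitive across `q` satisfies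
`0 ≤ Hb - Hw = |F(q)|² ≤ ρ_r(δ)` ("`|H(B) - H(W)| ≤ δ_r(δ)`"), uniformly in the domain (Rem. 4.9).
[cite: Smirnov2010, Lemma 4.8, Rem. 4.9] -/
theorem dartFlux_le_of_infDist :
    ∀ r : ℝ, 0 < r → ∃ ρ : ℝ → ℝ, Tendsto ρ (𝓝[>] (0 : ℝ)) (𝓝 0) ∧
      ∀ (D : RandomPlanarGeometry.JordanDomain) (E : DiscreteDobrushin), E.Ω = D.carrier →
        ∀ (hE : E.IsZdAdmissible) [Fintype (meshDomain E.Ω E.δ)] (q : Site 2 × Fin 4),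
        cSrc q ∈ (discreteDomainGraph E.Ω E.δ).edgeSet →
          (r ≤ Metric.infDist (medialPoint E.δ (cSrc q)) (meshPoint E.δ '' E.zdArcA) ∨
            r ≤ Metric.infDist (medialPoint E.δ (cSrc q)) (meshPoint E.δ '' E.zdArcB)) →
          dartFlux E hE q ≤ ρ E.δ := by
  intro r hr
  obtain ⟨ρ, hρ, h⟩ := fkInterface_passageProb_le_holds r hr
  refine ⟨fun δ => ρ δ ^ 2, by simpa using hρ.pow 2, fun D E hΩ hE _ q hq hfar => ?_⟩
  have h1 := h D E hΩ hE (cSrc q) hq hfar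
  have h2 := dartFlux_le_passageProb_sq hE q
  have h3 : 0 ≤ (fkDobrushinMeasure E).real {ω | cSrc q ∈ fkInterface E ω} := measureReal_nonneg
  calc dartFlux E hE q ≤ ((fkDobrushinMeasure E).real {ω | cSrc q ∈ fkInterface E ω}) ^ 2 := h2
    _ ≤ ρ E.δ ^ 2 := by gcongr

end Literature.Probability.LatticeModels
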